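import Summits.QuantumFields.QCD.Theorems.QuarksAsStableActionCriticalLineDiamagnetismStubFrequencyDiamagnetismAux1

/-!
# Route B infrastructure for stub `stub_heavyFrequencyGain` of line `Sketch` — the 2D frequency operator on RECTANGULAR
two-tori `ℤ/L₁ × ℤ/L₂`: definitions and spin symmetries
(crux `Summit.QuantumFields.QCD.Theses.QuarksAsStableAction.CriticalLineDiamagnetism`, item stmt-QuantumFields-9734,
static route for odd tori, Route B of the heavy-frequency gain)

The reflection-positivity route to the heavy-frequency gain runs the transfer-matrix pipeline of `stub_frequencyDiamagnetism`
(files `…StubFrequencyDiamagnetismAux1–3`) on rectangular lattices `ℤ/L₁ × ℤ/L₂` (time length `L₁ ≠` space length `L₂`: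
reflection-doubled patterns, static comparison fields of all time lengths).  This file is the two-length copy of the
definitions of `…StubFrequencyDiamagnetismAux1`: the frequency operator `freqOpR g A m ω₀ ω₁` of a field
`A : ℤ/L₁ → ℤ/L₂ → Fin 4 → U(3)` (the SAME formula as `freqOp`, the seam tests `= −1` read in each `ZMod` separately), its
time form `tfreqOpR` (spin slots `γ₂, γ₁, γ₀, γ₃`), its spin blocks `freqBlockR`, and the `A`-dependent transfer slice data
with row index `t : ℤ/L₁` on the slice space `ℤ/L₂ × colour × spin` (`hop3R`, `massHopR`, `hopCoeffR`, `sliceOpR`, `sliceBhR`,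
`link2R`, `link2R'`, `oneStepR`; the projections `projP L₂`, `projM L₂` of the square file are reused).  Spin conjugation acts
on the slots (`spinLift_conj_freqOpR`), so `det freqOpR (γ ∘ (0 i) ∘ π) = det freqOpR (γ ∘ π)` (`det_freqOpR_swap`) and
`det tfreqOpR A = det freqOpR γ A` (`det_tfreqOpR`).  At `L₁ = L₂` everything is the square vocabulary by `rfl`
(`freqOpR_eq_freqOp`, registered, and the `…R_eq` lemmas).
-/

noncomputable section

open scoped BigOperators Matrix ComplexConjugate Kronecker
open Finset
open Literature.MathematicalPhysics.QuantumLattice Literature.MathematicalPhysics.QuantumFieldTheory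
  Literature.Probability.LatticeModels

namespace Summit.QuantumFields.QCD.Cruxes.CriticalLineDiamagnetism.ChessboardCellGain

namespace FrequencyDiamagnetism

open Matrix Complex
open Summit.QuantumFields.QCD.Cruxes.StableActionBridge.Sketch
open Summit.QuantumFields.QCD.Theorems.UnquenchedChessboardBoundLine

/-! ### The frequency operator on a rectangular two-torus -/

/-- The 2D frequency operator of a field `A` on the rectangular two-torus `ℤ/L₁ × ℤ/L₂` at mass `m` and frequencies
`(ω₀, ω₁)`, with the spin matrix `g μ` in slot `μ` — the same formula as `freqOp` (seam tests in each `ZMod` separately). -/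
def freqOpR {L₁ L₂ : ℕ} (g : Fin 4 → Matrix (Fin 4) (Fin 4) ℂ)
    (A : ZMod L₁ → ZMod L₂ → Fin 4 → Matrix.unitaryGroup (Fin 3) ℂ) (m ω₀ ω₁ : ℝ) :
    Matrix ((ZMod L₁ × ZMod L₂) × Fin 3 × Fin 4) ((ZMod L₁ × ZMod L₂) × Fin 3 × Fin 4) ℂ :=
  Matrix.of fun (p q : (ZMod L₁ × ZMod L₂) × Fin 3 × Fin 4) =>
    (if p.1 = q.1 ∧ p.2.1 = q.2.1 then
        (((m + 4 - Real.cos ω₀ - Real.cos ω₁ : ℝ) : ℂ) * (1 : Matrix (Fin 4) (Fin 4) ℂ) p.2.2 q.2.2 +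
          Complex.I * (((Real.sin ω₀ : ℝ) : ℂ) * g 0 p.2.2 q.2.2 +
            ((Real.sin ω₁ : ℝ) : ℂ) * g 1 p.2.2 q.2.2))
      else 0) -
      (1 / 2 : ℂ) *
        ((if q.1 = (p.1.1 + 1, p.1.2) then
            ((1 : Matrix (Fin 4) (Fin 4) ℂ) - g 2) p.2.2 q.2.2 *
              ((if p.1.1 = -1 then (-1 : ℂ) else 1) * (A p.1.1 p.1.2 2 : Matrix (Fin 3) (Fin 3) ℂ) p.2.1 q.2.1)
          else 0) +
         (if p.1 = (q.1.1 + 1, q.1.2) then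
            ((1 : Matrix (Fin 4) (Fin 4) ℂ) + g 2) p.2.2 q.2.2 *
              ((if q.1.1 = -1 then (-1 : ℂ) else 1) * (star (A q.1.1 q.1.2 2 : Matrix (Fin 3) (Fin 3) ℂ)) p.2.1 q.2.1)
          else 0) +
         (if q.1 = (p.1.1, p.1.2 + 1) then
            ((1 : Matrix (Fin 4) (Fin 4) ℂ) - g 3) p.2.2 q.2.2 *
              ((if p.1.2 = -1 then (-1 : ℂ) else 1) * (A p.1.1 p.1.2 3 : Matrix (Fin 3) (Fin 3) ℂ) p.2.1 q.2.1)
          else 0) +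
         (if p.1 = (q.1.1, q.1.2 + 1) then
            ((1 : Matrix (Fin 4) (Fin 4) ℂ) + g 3) p.2.2 q.2.2 *
              ((if q.1.2 = -1 then (-1 : ℂ) else 1) * (star (A q.1.1 q.1.2 3 : Matrix (Fin 3) (Fin 3) ℂ)) p.2.1 q.2.1)
          else 0))

/-- The time form of the rectangular frequency operator: spin slots `γ₂, γ₁, γ₀, γ₃` (the hops along the first coordinate,
of length `L₁`, carry the Wilson time projections `½(1 ∓ γ₀)`). -/
def tfreqOpR {L₁ L₂ : ℕ} (A : ZMod L₁ → ZMod L₂ → Fin 4 → Matrix.unitaryGroup (Fin 3) ℂ) (m ω₀ ω₁ : ℝ) :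
    Matrix ((ZMod L₁ × ZMod L₂) × Fin 3 × Fin 4) ((ZMod L₁ × ZMod L₂) × Fin 3 × Fin 4) ℂ :=
  freqOpR (fun μ => euclideanGamma (Equiv.swap (0 : Fin 4) 2 μ)) A m ω₀ ω₁

/-- The `4 × 4` spin block of `freqOpR g A m ω₀ ω₁` between the (site, colour) pairs `a` and `b`. -/
def freqBlockR {L₁ L₂ : ℕ} (g : Fin 4 → Matrix (Fin 4) (Fin 4) ℂ)
    (A : ZMod L₁ → ZMod L₂ → Fin 4 → Matrix.unitaryGroup (Fin 3) ℂ) (m ω₀ ω₁ : ℝ)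
    (a b : (ZMod L₁ × ZMod L₂) × Fin 3) : Matrix (Fin 4) (Fin 4) ℂ :=
  (if a.1 = b.1 ∧ a.2 = b.2 then
      ((m + 4 - Real.cos ω₀ - Real.cos ω₁ : ℝ) : ℂ) • (1 : Matrix (Fin 4) (Fin 4) ℂ) +
        Complex.I • ((((Real.sin ω₀ : ℝ) : ℂ)) • g 0 + ((Real.sin ω₁ : ℝ) : ℂ) • g 1)
    else 0) -
    (1 / 2 : ℂ) •
      ((if b.1 = (a.1.1 + 1, a.1.2) then
          ((if a.1.1 = -1 then (-1 : ℂ) else 1) * (A a.1.1 a.1.2 2 : Matrix (Fin 3) (Fin 3) ℂ) a.2 b.2) •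
            ((1 : Matrix (Fin 4) (Fin 4) ℂ) - g 2)
        else 0) +
       (if a.1 = (b.1.1 + 1, b.1.2) then
          ((if b.1.1 = -1 then (-1 : ℂ) else 1) * (star (A b.1.1 b.1.2 2 : Matrix (Fin 3) (Fin 3) ℂ)) a.2 b.2) •
            ((1 : Matrix (Fin 4) (Fin 4) ℂ) + g 2)
        else 0) +
       (if b.1 = (a.1.1, a.1.2 + 1) then
          ((if a.1.2 = -1 then (-1 : ℂ) else 1) * (A a.1.1 a.1.2 3 : Matrix (Fin 3) (Fin 3) ℂ) a.2 b.2) •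
            ((1 : Matrix (Fin 4) (Fin 4) ℂ) - g 3)
        else 0) +
       (if a.1 = (b.1.1, b.1.2 + 1) then
          ((if b.1.2 = -1 then (-1 : ℂ) else 1) * (star (A b.1.1 b.1.2 3 : Matrix (Fin 3) (Fin 3) ℂ)) a.2 b.2) •
            ((1 : Matrix (Fin 4) (Fin 4) ℂ) + g 3)
        else 0))

/-! ### The transfer slice data (row index `t : ℤ/L₁`, slice space `ℤ/L₂ × colour × spin`) -/

/-- The seam-signed gauge hop of row `t` along the second coordinate, on `ℤ/L₂ × colour`. -/
def hop3R {L₁ L₂ : ℕ} (A : ZMod L₁ → ZMod L₂ → Fin 4 → Matrix.unitaryGroup (Fin 3) ℂ) (t : ZMod L₁) :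
    Matrix (ZMod L₂ × Fin 3) (ZMod L₂ × Fin 3) ℂ :=
  Matrix.of fun a b : ZMod L₂ × Fin 3 =>
    if b.1 = a.1 + 1 then ((if a.1 = -1 then (-1 : ℂ) else 1) • (A t a.1 3 : Matrix (Fin 3) (Fin 3) ℂ)) a.2 b.2 else 0

/-- The spin-blind slice operator `B_t = M_ω·1 − ½(H_t + H_tᴴ)` of row `t`. -/
def massHopR {L₁ L₂ : ℕ} (A : ZMod L₁ → ZMod L₂ → Fin 4 → Matrix.unitaryGroup (Fin 3) ℂ) (m ω₀ ω₁ : ℝ) (t : ZMod L₁) :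
    Matrix (ZMod L₂ × Fin 3) (ZMod L₂ × Fin 3) ℂ :=
  Matrix.diagonal (fun _ => ((m + 4 - Real.cos ω₀ - Real.cos ω₁ : ℝ) : ℂ)) - (1 / 2 : ℂ) • (hop3R A t + (hop3R A t)ᴴ)

/-- The coefficients of `γ₁, γ₂, γ₃` in the slice operator of row `t`: `i sin ω₁·1`, `i sin ω₀·1`, `½(H_t − H_tᴴ)`. -/
def hopCoeffR {L₁ L₂ : ℕ} (A : ZMod L₁ → ZMod L₂ → Fin 4 → Matrix.unitaryGroup (Fin 3) ℂ) (ω₀ ω₁ : ℝ) (t : ZMod L₁) :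
    Fin 3 → Matrix (ZMod L₂ × Fin 3) (ZMod L₂ × Fin 3) ℂ :=
  ![(Complex.I * ((Real.sin ω₁ : ℝ) : ℂ)) • 1, (Complex.I * ((Real.sin ω₀ : ℝ) : ℂ)) • 1,
    (1 / 2 : ℂ) • (hop3R A t - (hop3R A t)ᴴ)]

/-- The slice operator `A_t = B_t ⊗ 1 + Σ_j C_{t,j} ⊗ γ_{j+1}` of row `t` (in Kronecker form). -/
def sliceOpR {L₁ L₂ : ℕ} [NeZero L₂] (A : ZMod L₁ → ZMod L₂ → Fin 4 → Matrix.unitaryGroup (Fin 3) ℂ) (m ω₀ ω₁ : ℝ)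
    (t : ZMod L₁) : Matrix (ZMod L₂ × Fin 3 × Fin 4) (ZMod L₂ × Fin 3 × Fin 4) ℂ :=
  Matrix.reindexAlgEquiv ℂ ℂ (Equiv.prodAssoc (ZMod L₂) (Fin 3) (Fin 4))
    (massHopR A m ω₀ ω₁ t ⊗ₖ (1 : Matrix (Fin 4) (Fin 4) ℂ) +
      ∑ j : Fin 3, hopCoeffR A ω₀ ω₁ t j ⊗ₖ euclideanGamma j.succ)

/-- The spin-diagonal lift `B̂_t = B_t ⊗ 1` of the spin-blind slice operator (in Kronecker form). -/
def sliceBhR {L₁ L₂ : ℕ} [NeZero L₂] (A : ZMod L₁ → ZMod L₂ → Fin 4 → Matrix.unitaryGroup (Fin 3) ℂ) (m ω₀ ω₁ : ℝ)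
    (t : ZMod L₁) : Matrix (ZMod L₂ × Fin 3 × Fin 4) (ZMod L₂ × Fin 3 × Fin 4) ℂ :=
  Matrix.reindexAlgEquiv ℂ ℂ (Equiv.prodAssoc (ZMod L₂) (Fin 3) (Fin 4))
    (massHopR A m ω₀ ω₁ t ⊗ₖ (1 : Matrix (Fin 4) (Fin 4) ℂ))

/-- The forward temporal transporter `W_t = σ_t A(t,·,2) ⊗ 1_spin` of row `t` (`σ_t = −1` on the seam `t = −1` of `ℤ/L₁`). -/
def link2R {L₁ L₂ : ℕ} (A : ZMod L₁ → ZMod L₂ → Fin 4 → Matrix.unitaryGroup (Fin 3) ℂ) (t : ZMod L₁) :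
    Matrix (ZMod L₂ × Fin 3 × Fin 4) (ZMod L₂ × Fin 3 × Fin 4) ℂ :=
  Matrix.of fun a b : ZMod L₂ × Fin 3 × Fin 4 => if a.1 = b.1 ∧ a.2.2 = b.2.2 then
    ((if t = -1 then (-1 : ℂ) else 1) • (A t a.1 2 : Matrix (Fin 3) (Fin 3) ℂ)) a.2.1 b.2.1 else 0

/-- The backward temporal transporter `W′_t = σ_t A(t,·,2)ᴴ ⊗ 1_spin` of row `t`. -/
def link2R' {L₁ L₂ : ℕ} (A : ZMod L₁ → ZMod L₂ → Fin 4 → Matrix.unitaryGroup (Fin 3) ℂ) (t : ZMod L₁) :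
    Matrix (ZMod L₂ × Fin 3 × Fin 4) (ZMod L₂ × Fin 3 × Fin 4) ℂ :=
  Matrix.of fun a b : ZMod L₂ × Fin 3 × Fin 4 => if a.1 = b.1 ∧ a.2.2 = b.2.2 then
    ((if t = -1 then (-1 : ℂ) else 1) • (star (A t a.1 2 : Matrix (Fin 3) (Fin 3) ℂ))) a.2.1 b.2.1 else 0

/-- Lüscher's dressed one-step matrix `M_t = (1 + P⁺C_tP⁻)(B̂_tP⁺ + B̂_t⁻¹P⁻)(1 − P⁻C_tP⁺)`, `C_t = A_t − B̂_t`, of row `t`. -/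
def oneStepR {L₁ L₂ : ℕ} [NeZero L₂] (A : ZMod L₁ → ZMod L₂ → Fin 4 → Matrix.unitaryGroup (Fin 3) ℂ) (m ω₀ ω₁ : ℝ)
    (t : ZMod L₁) : Matrix (ZMod L₂ × Fin 3 × Fin 4) (ZMod L₂ × Fin 3 × Fin 4) ℂ :=
  (1 + projP L₂ * (sliceOpR A m ω₀ ω₁ t - sliceBhR A m ω₀ ω₁ t) * projM L₂) *
    (sliceBhR A m ω₀ ω₁ t * projP L₂ + (sliceBhR A m ω₀ ω₁ t)⁻¹ * projM L₂) *
    (1 - projM L₂ * (sliceOpR A m ω₀ ω₁ t - sliceBhR A m ω₀ ω₁ t) * projP L₂)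

/-! ### At equal lengths the rectangular vocabulary is the square one -/

section Square

variable {L : ℕ} (g : Fin 4 → Matrix (Fin 4) (Fin 4) ℂ) (A : ZMod L → ZMod L → Fin 4 → Matrix.unitaryGroup (Fin 3) ℂ)
  (m ω₀ ω₁ : ℝ) (t : ZMod L)

/-- `tfreqOpR = tfreqOp` at equal lengths. -/
theorem tfreqOpR_eq : tfreqOpR A m ω₀ ω₁ = tfreqOp A m ω₀ ω₁ := rfl

/-- `freqBlockR = freqBlock` at equal lengths. -/
theorem freqBlockR_eq : freqBlockR g A m ω₀ ω₁ = freqBlock g A m ω₀ ω₁ := rfl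

/-- `hop3R = hop3` at equal lengths. -/
theorem hop3R_eq : hop3R A t = hop3 A t := rfl

/-- `massHopR = massHop` at equal lengths. -/
theorem massHopR_eq : massHopR A m ω₀ ω₁ t = massHop A m ω₀ ω₁ t := rfl

/-- `hopCoeffR = hopCoeff` at equal lengths. -/
theorem hopCoeffR_eq : hopCoeffR A ω₀ ω₁ t = hopCoeff A ω₀ ω₁ t := rfl

/-- `link2R = link2` at equal lengths. -/
theorem link2R_eq_link2 : link2R A t = link2 A t := rfl

/-- `link2R' = link2'` at equal lengths. -/
theorem link2R'_eq_link2' : link2R' A t = link2' A t := rfl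

variable [NeZero L]

/-- `sliceOpR = sliceOp` at equal lengths. -/
theorem sliceOpR_eq : sliceOpR A m ω₀ ω₁ t = sliceOp A m ω₀ ω₁ t := rfl

/-- `sliceBhR = sliceBh` at equal lengths. -/
theorem sliceBhR_eq : sliceBhR A m ω₀ ω₁ t = sliceBh A m ω₀ ω₁ t := rfl

/-- `oneStepR = oneStep` at equal lengths. -/
theorem oneStepR_eq : oneStepR A m ω₀ ω₁ t = oneStep A m ω₀ ω₁ t := rfl

end Square

/-! ### Spin conjugation -/

/-- `freqOpR` is assembled from its spin blocks `freqBlockR`. -/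
theorem freqOpR_eq_blocks {L₁ L₂ : ℕ} (g : Fin 4 → Matrix (Fin 4) (Fin 4) ℂ)
    (A : ZMod L₁ → ZMod L₂ → Fin 4 → Matrix.unitaryGroup (Fin 3) ℂ) (m ω₀ ω₁ : ℝ) :
    freqOpR g A m ω₀ ω₁ = Matrix.of fun p q : (ZMod L₁ × ZMod L₂) × Fin 3 × Fin 4 =>
      freqBlockR g A m ω₀ ω₁ (p.1, p.2.1) (q.1, q.2.1) p.2.2 q.2.2 := by
  ext p q
  simp only [freqOpR, freqBlockR, Matrix.of_apply, Matrix.sub_apply, Matrix.add_apply, Matrix.smul_apply,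
    ite_zero_apply, smul_eq_mul]
  split_ifs <;> ring

/-- **Spin conjugation of the blocks**: `S · freqBlockR g · S′ = freqBlockR (S g S′)` for `S S′ = 1`. -/
theorem conj_freqBlockR {L₁ L₂ : ℕ} (S S' : Matrix (Fin 4) (Fin 4) ℂ) (hS : S * S' = 1)
    (g : Fin 4 → Matrix (Fin 4) (Fin 4) ℂ) (A : ZMod L₁ → ZMod L₂ → Fin 4 → Matrix.unitaryGroup (Fin 3) ℂ)
    (m ω₀ ω₁ : ℝ) (a b : (ZMod L₁ × ZMod L₂) × Fin 3) :
    S * freqBlockR g A m ω₀ ω₁ a b * S' = freqBlockR (fun μ => S * g μ * S') A m ω₀ ω₁ a b := by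
  simp only [freqBlockR, Matrix.mul_sub, Matrix.sub_mul, Matrix.mul_add, Matrix.add_mul, Matrix.mul_smul,
    Matrix.smul_mul, mul_ite, ite_mul, Matrix.mul_zero, Matrix.zero_mul, Matrix.mul_one, hS, Matrix.mul_assoc]

/-- **Spin conjugation of the rectangular frequency operator**:
`(1 ⊗ 1 ⊗ S) · freqOpR g · (1 ⊗ 1 ⊗ S′) = freqOpR (S g S′)` for `S S′ = 1`. -/
theorem spinLift_conj_freqOpR {L₁ L₂ : ℕ} [NeZero L₁] [NeZero L₂] (S S' : Matrix (Fin 4) (Fin 4) ℂ) (hS : S * S' = 1)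
    (g : Fin 4 → Matrix (Fin 4) (Fin 4) ℂ) (A : ZMod L₁ → ZMod L₂ → Fin 4 → Matrix.unitaryGroup (Fin 3) ℂ)
    (m ω₀ ω₁ : ℝ) :
    (Matrix.of fun a b : (ZMod L₁ × ZMod L₂) × Fin 3 × Fin 4 =>
        if a.1 = b.1 ∧ a.2.1 = b.2.1 then S a.2.2 b.2.2 else 0) * freqOpR g A m ω₀ ω₁ *
        (Matrix.of fun a b : (ZMod L₁ × ZMod L₂) × Fin 3 × Fin 4 =>
          if a.1 = b.1 ∧ a.2.1 = b.2.1 then S' a.2.2 b.2.2 else 0) =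
      freqOpR (fun μ => S * g μ * S') A m ω₀ ω₁ := by
  rw [freqOpR_eq_blocks, freqOpR_eq_blocks, spinLift_conj_blocks]
  simp only [conj_freqBlockR S S' hS]

/-- **The rectangular frequency determinant is blind to a transposition `(0 i)` of the spin slots** (`i ≠ 0`, any slot
map `π`): conjugation by the lift of `S_i = γ₅(γ₀ − γ_i)`. -/
theorem det_freqOpR_swap {L₁ L₂ : ℕ} [NeZero L₁] [NeZero L₂] {i : Fin 4} (hi : i ≠ 0) (π : Fin 4 → Fin 4)
    (A : ZMod L₁ → ZMod L₂ → Fin 4 → Matrix.unitaryGroup (Fin 3) ℂ) (m ω₀ ω₁ : ℝ) :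
    (freqOpR (fun μ => euclideanGamma (Equiv.swap (0 : Fin 4) i (π μ))) A m ω₀ ω₁).det =
      (freqOpR (fun μ => euclideanGamma (π μ)) A m ω₀ ω₁).det := by
  have hSS' := AxisSwap.spinS_mul_spinS' hi
  have hconj : (fun μ => euclideanGamma (Equiv.swap (0 : Fin 4) i (π μ))) = fun μ =>
      gammaFive * (euclideanGamma 0 - euclideanGamma i) * euclideanGamma (π μ) *
        ((2 : ℂ)⁻¹ • ((euclideanGamma 0 - euclideanGamma i) * gammaFive)) := by
    funext μ
    rw [AxisSwap.spinS_mul_euclideanGamma hi, Matrix.mul_assoc, hSS', Matrix.mul_one]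
  rw [hconj, ← spinLift_conj_freqOpR _ _ hSS', det_spinLift_conj _ _ hSS']

/-- **The rectangular frequency determinant equals the determinant of its time form**: `det tfreqOpR A = det freqOpR γ A`. -/
theorem det_tfreqOpR {L₁ L₂ : ℕ} [NeZero L₁] [NeZero L₂] (A : ZMod L₁ → ZMod L₂ → Fin 4 → Matrix.unitaryGroup (Fin 3) ℂ)
    (m ω₀ ω₁ : ℝ) :
    (tfreqOpR A m ω₀ ω₁).det = (freqOpR euclideanGamma A m ω₀ ω₁).det :=
  det_freqOpR_swap (by decide) id A m ω₀ ω₁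

end FrequencyDiamagnetism

/-! ### Registered auxiliary theorem -/

/-- **Aux stub `freqOpR_eq_freqOp`**: at equal lengths `L₁ = L₂ = L` the rectangular frequency operator IS the square one
(`FrequencyDiamagnetism.freqOp`, whose `γ`-instance is literally the `fD` of `stub_frequencyDiamagnetism`), by `rfl`. -/
theorem freqOpR_eq_freqOp : ∀ (L : ℕ) (g : Fin 4 → Matrix (Fin 4) (Fin 4) ℂ) (A : ZMod L → ZMod L → Fin 4 → Matrix.unitaryGroup (Fin 3) ℂ) (m ω₀ ω₁ : ℝ), FrequencyDiamagnetism.freqOpR g A m ω₀ ω₁ = FrequencyDiamagnetism.freqOp g A m ω₀ ω₁ :=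
  fun _ _ _ _ _ _ => rfl

end Summit.QuantumFields.QCD.Cruxes.CriticalLineDiamagnetism.ChessboardCellGain

end
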